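import Summits.NavierStokesRegularity.NavierStokesRegularity.Theorems.EulerZoomLiouvillePowerGaugeEulerLiouvilleDSSEndpointLocalEnergyEquality
import HarnessLib

/-!
# Rung C2 of the crux `EulerZoomLiouville.PowerGaugeEulerLiouville` at the endpoint `ρ = 1/2`:
# the local energy EQUALITY holds for SIGNED tests (DSS endpoint members are distributional
# solutions of the local energy balance with `=`)

Route №10 `EulerZoomLiouville` (NavierStokesRegularity), crux E = stmt-NavierStokesRegularity-19832.
Seat ns-typeII-p1 (g5), completing g4's `localEnergyEquality_of_energy_ae_const_half` /
`dss_half_localEnergyEquality` (`…DSSEndpointLocalEnergyEquality.lean`), which state the vanishing of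
the class functional `L(φ) = ∫∫ (|u|² ∂_tφ + (|u|²+2p)⟪u,∇φ⟫)` for NONNEGATIVE tests only.

* `localEnergyEquality_of_energy_ae_const_half_signed` — an endpoint member (`ρ = 1/2`) with a.e.
  constant total energy has `L(φ) = 0` for EVERY space–time test `φ` on the slab (any sign):
  with a product cut-off `Φ = χ ⊗ σ` equal to `1` on the support of `φ` and `M = sup |φ|`, both
  `M Φ` and `M Φ − φ` are nonnegative tests, so `L` vanishes on them (g4), and
  `L(φ) = L(MΦ) − L(MΦ − φ) = 0` by linearity.
* `dss_half_localEnergyEquality_signed` — every discretely self-similar member at `ρ = 1/2`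
  (`u(τ,y) = l^{3/2}u(l^{5/2}τ, ly)`, any `l > 1`) satisfies the local energy equality against every
  test: `∂_t|u|² + div((|u|²+2p)u) = 0` in `𝒟'((−∞,0) × ℝ³)`.

WHAT THIS IS NOT: not NS, not E, not rung C2 — structure of endpoint members, `--supports` stmt-19832.
[folklore]
-/

noncomputable section

-- the summit and its single problem share the name `NavierStokesRegularity` (D-0017 nested layout)
set_option linter.dupNamespace false

open MeasureTheory Set Filter Topology Metric Function TopologicalSpace
open scoped ENNReal NNReal InnerProductSpace RealInnerProductSpace

namespace Summit.NavierStokesRegularity.NavierStokesRegularity.Theorems.PowerGaugeEulerLiouville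

open Literature.Analysis Literature.Analysis.FunctionSpaces Literature.Analysis.FluidPDE

section Signed

variable {u : ℝ → EuclideanSpace ℝ (Fin 3) → EuclideanSpace ℝ (Fin 3)}
  {p : ℝ → EuclideanSpace ℝ (Fin 3) → ℝ}
  {H : ℝ → EuclideanSpace ℝ (Fin 3) → EuclideanSpace ℝ (Fin 3) →L[ℝ] EuclideanSpace ℝ (Fin 3)}
  {c : ℝ≥0}

/-- **Constant energy ⇒ local energy EQUALITY for signed tests at the endpoint.**  Let
`(u, p, H, c)` satisfy the three hypotheses of the crux at `ρ = 1/2` with a.e. constant total energy.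
Then `∫∫ (|u|² ∂_tφ + (|u|² + 2p)⟪u, ∇φ⟫) = 0` for EVERY space–time test `φ` on the slab. [folklore] -/
theorem localEnergyEquality_of_energy_ae_const_half_signed
    (hsw : IsSuitableWeakSolutionOn (slab (EuclideanSpace ℝ (Fin 3)) (Iio 0) isOpen_Iio) 0 0 u p)
    (hH : HasWeakSpatialGradientOn (slab (EuclideanSpace ℝ (Fin 3)) (Iio 0) isOpen_Iio) u H)
    (hgauge : ∀ a : ℝ, 0 < a →
      ENNReal.ofReal (a ^ (2 * (1 / 2 : ℝ))) * cknA a (0 : ℝ × EuclideanSpace ℝ (Fin 3)) u +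
          ENNReal.ofReal (a ^ (1 / 2 : ℝ)) * cknE a (0 : ℝ × EuclideanSpace ℝ (Fin 3)) H +
        ENNReal.ofReal (a ^ (2 * (1 / 2 : ℝ))) * cknD a (0 : ℝ × EuclideanSpace ℝ (Fin 3)) p ≤ (c : ℝ≥0∞))
    {E₀ : ℝ≥0∞} (hE : ∀ᵐ τ : ℝ, τ < 0 → ∫⁻ y, ‖u τ y‖ₑ ^ 2 = E₀)
    {φ : ℝ → EuclideanSpace ℝ (Fin 3) → ℝ}
    (hφ : IsSpaceTimeTestOn (slab (EuclideanSpace ℝ (Fin 3)) (Iio 0) isOpen_Iio) φ) :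
    (∫ t, ∫ x, (‖u t x‖ ^ 2 * timeDeriv φ t x +
      (‖u t x‖ ^ 2 + 2 * p t x) * ⟪u t x, gradient (φ t) x⟫)) = 0 := by
  set Q : Opens (ℝ × EuclideanSpace ℝ (Fin 3)) := slab (EuclideanSpace ℝ (Fin 3)) (Iio 0) isOpen_Iio
    with hQ
  -- the energy-flux integrand of a test
  set R : (ℝ → EuclideanSpace ℝ (Fin 3) → ℝ) → ℝ × EuclideanSpace ℝ (Fin 3) → ℝ := fun ψ z =>
    ‖u z.1 z.2‖ ^ 2 * timeDeriv ψ z.1 z.2 +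
      (‖u z.1 z.2‖ ^ 2 + 2 * p z.1 z.2) * ⟪u z.1 z.2, gradient (ψ z.1) z.2⟫ with hR
  -- the nonnegative-test equality of g4, in the `R`-integral form
  have hL0 : ∀ {ψ : ℝ → EuclideanSpace ℝ (Fin 3) → ℝ}, IsSpaceTimeTestOn Q ψ → (∀ t x, 0 ≤ ψ t x) →
      (∫ z, R ψ z) = 0 := by
    intro ψ hψ hψ0
    rw [← (energyFlux_integrable hsw hψ).2]
    exact localEnergyEquality_of_energy_ae_const_half hsw hH hgauge hE hψ hψ0
  rw [(energyFlux_integrable hsw hφ).2]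
  change (∫ z, R φ z) = 0
  have hRφ : Integrable (R φ) volume := (energyFlux_integrable hsw hφ).1
  -- ## data of the test: support box, bound
  set K := tsupport (uncurry φ) with hK
  have hKc : IsCompact K := hφ.hasCompactSupport
  have hKQ : K ⊆ (Q : Set (ℝ × EuclideanSpace ℝ (Fin 3))) := hφ.tsupport_subset
  obtain ⟨-, -, hgφ0⟩ := hφ.continuous_gradient_field
  have hTφ0 : ∀ z ∉ K, timeDeriv φ z.1 z.2 = 0 := fun z hz =>
    IsSpaceTimeTestOn.timeDeriv_eq_zero_of_notMem hz
  rcases K.eq_empty_or_nonempty with hKe | hKne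
  · -- empty support: the integrand vanishes identically
    have h0 : ∀ z, R φ z = 0 := fun z => by
      have hz : z ∉ K := by rw [hKe]; exact notMem_empty _
      show ‖u z.1 z.2‖ ^ 2 * timeDeriv φ z.1 z.2 +
        (‖u z.1 z.2‖ ^ 2 + 2 * p z.1 z.2) * ⟪u z.1 z.2, gradient (φ z.1) z.2⟫ = 0
      rw [hTφ0 z hz, hgφ0 z hz, inner_zero_right, mul_zero, mul_zero, add_zero]
    rw [integral_congr_ae (Eventually.of_forall h0), integral_zero]
  obtain ⟨zm, hzmK, hzm⟩ := hKc.exists_isMaxOn hKne continuous_fst.continuousOn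
  have hb₀ : zm.1 < 0 := by simpa [hQ] using hKQ hzmK
  obtain ⟨R₀, hR₀⟩ := hKc.isBounded.subset_closedBall (0 : ℝ × EuclideanSpace ℝ (Fin 3))
  have hKt : ∀ z ∈ K, -(|R₀| + 1) ≤ z.1 ∧ z.1 ≤ zm.1 := fun z hz => by
    have h1 : ‖z‖ ≤ R₀ := by simpa using hR₀ hz
    have h2 : |z.1| ≤ R₀ := (norm_fst_le z).trans h1
    exact ⟨by linarith [neg_abs_le z.1, le_abs_self R₀], hzm hz⟩
  have hKx : ∀ z ∈ K, ‖z.2‖ ≤ |R₀| := fun z hz => by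
    have h1 : ‖z‖ ≤ R₀ := by simpa using hR₀ hz
    exact ((norm_snd_le z).trans h1).trans (le_abs_self R₀)
  obtain ⟨M, hM⟩ := hφ.contDiff.continuous.bounded_above_of_compact_support hφ.hasCompactSupport
  have hM0 : 0 ≤ M := (norm_nonneg _).trans (hM zm)
  have hφM : ∀ t x, φ t x ≤ M := fun t x => by
    have := hM (t, x); rw [Real.norm_eq_abs] at this; exact (le_abs_self _).trans this
  -- ## the time cut-off `χ`: `= 1` on `[−|R₀|−1, b₀]`, supported in `t < b₀/2 < 0`
  set b₀ : ℝ := zm.1 with hb₀def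
  set c₀ : ℝ := (b₀ - |R₀| - 2) / 2 with hc₀
  have hrIn : 0 < (b₀ + |R₀| + 2) / 2 := by
    have := (hKt zm hzmK).1; linarith
  let χ : ContDiffBump c₀ := ⟨(b₀ + |R₀| + 2) / 2, (b₀ + |R₀| + 2) / 2 + (-b₀) / 2, hrIn, by linarith⟩
  have hχtop : c₀ + χ.rOut = b₀ / 2 := by
    show (b₀ - |R₀| - 2) / 2 + ((b₀ + |R₀| + 2) / 2 + (-b₀) / 2) = b₀ / 2; ring
  have hχone : ∀ t, -(|R₀| + 1) ≤ t → t ≤ b₀ → (χ : ℝ → ℝ) t = 1 := fun t h1 h2 => by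
    refine χ.one_of_mem_closedBall ?_
    rw [mem_closedBall, Real.dist_eq, abs_le]
    show -((b₀ + |R₀| + 2) / 2) ≤ t - (b₀ - |R₀| - 2) / 2 ∧ t - (b₀ - |R₀| - 2) / 2 ≤ (b₀ + |R₀| + 2) / 2
    constructor <;> linarith
  have hχzero : ∀ t, t ∉ Icc (c₀ - χ.rOut) (c₀ + χ.rOut) → (χ : ℝ → ℝ) t = 0 := fun t ht => by
    refine χ.zero_of_le_dist ?_
    rw [Real.dist_eq]
    rw [mem_Icc, not_and_or, not_le, not_le] at ht
    rcases ht with h | h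
    · rw [abs_of_neg (by linarith)]; linarith
    · rw [abs_of_pos (by linarith)]; linarith
  have hχ01 : ∀ t, 0 ≤ (χ : ℝ → ℝ) t ∧ (χ : ℝ → ℝ) t ≤ 1 := fun t => ⟨χ.nonneg, χ.le_one⟩
  have hχd : ContDiff ℝ (⊤ : ℕ∞) (χ : ℝ → ℝ) := χ.contDiff
  -- ## the time window of the slab containing the cut-off
  set αW : ℝ := c₀ - χ.rOut - 1 with hαW
  have hab : Ioo αW 0 ×ˢ (univ : Set (EuclideanSpace ℝ (Fin 3))) ⊆
      (Q : Set (ℝ × EuclideanSpace ℝ (Fin 3))) := by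
    rintro ⟨t, x⟩ ⟨ht, -⟩
    simpa [hQ] using ht.2
  have h₁ : Icc (c₀ - χ.rOut) (c₀ + χ.rOut) ⊆ Ioo αW 0 := fun t ht =>
    ⟨by rw [hαW]; linarith [ht.1], by rw [hχtop] at ht; linarith [ht.2]⟩
  -- ## one space cut-off `σ = cutoff R₁`, `R₁ = |R₀| + 1`, equal to `1` on `B_{R₁} ⊇ pr₂ K`
  obtain ⟨C, -, hcut⟩ := cutoffFacts
  set R₁ : ℝ := |R₀| + 1 with hR₁
  have hR₁0 : 0 < R₁ := by rw [hR₁]; positivity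
  have hσ : ContDiff ℝ (⊤ : ℕ∞) (cutoff (E := EuclideanSpace ℝ (Fin 3)) R₁) := (hcut R₁ hR₁0).1
  have hσc : HasCompactSupport (cutoff (E := EuclideanSpace ℝ (Fin 3)) R₁) := (hcut R₁ hR₁0).2.1
  have hσ0 : ∀ x, 0 ≤ cutoff (E := EuclideanSpace ℝ (Fin 3)) R₁ x := (hcut R₁ hR₁0).2.2.1
  have hσone : ∀ x ∈ ball (0 : EuclideanSpace ℝ (Fin 3)) R₁, cutoff R₁ x = 1 :=
    (hcut R₁ hR₁0).2.2.2.2.1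
  -- ## the product test `Φ = χ ⊗ σ` and the comparison test `M Φ − φ`
  set Φ : ℝ → EuclideanSpace ℝ (Fin 3) → ℝ := fun t x => (χ : ℝ → ℝ) t * cutoff R₁ x with hΦ
  have hΦtest : IsSpaceTimeTestOn Q Φ :=
    SuitableRestart.isSpaceTimeTestOn_mul hab hχd h₁ hχzero hσ hσc
  have hΦ0 : ∀ t x, 0 ≤ Φ t x := fun t x => mul_nonneg (hχ01 t).1 (hσ0 x)
  have hMΦtest : IsSpaceTimeTestOn Q (fun t x => M * Φ t x) := by
    have := hΦtest.clm_left (M • ContinuousLinearMap.id ℝ ℝ)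
    simpa using this
  have hMΦ0 : ∀ t x, 0 ≤ M * Φ t x := fun t x => mul_nonneg hM0 (hΦ0 t x)
  have hΨtest : IsSpaceTimeTestOn Q (fun t x => M * Φ t x - φ t x) := hMΦtest.sub hφ
  have hφK0 : ∀ t x, (t, x) ∉ K → φ t x = 0 := fun t x h =>
    show uncurry φ (t, x) = 0 from image_eq_zero_of_notMem_tsupport h
  have hΨ0 : ∀ t x, 0 ≤ M * Φ t x - φ t x := by
    intro t x
    by_cases hz : (t, x) ∈ K
    · have ht := hKt (t, x) hz
      have hx := hKx (t, x) hz
      have h1 : (χ : ℝ → ℝ) t = 1 := hχone t ht.1 ht.2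
      have h2 : cutoff R₁ x = 1 :=
        hσone x (by rw [mem_ball_zero_iff, hR₁]; exact lt_of_le_of_lt hx (lt_add_one _))
      have h3 : Φ t x = 1 := by simp only [hΦ, h1, h2, mul_one]
      rw [h3, mul_one]; linarith [hφM t x]
    · rw [hφK0 t x hz, sub_zero]; exact hMΦ0 t x
  -- ## linearity of the functional
  have hRΦ : Integrable (R Φ) volume := (energyFlux_integrable hsw hΦtest).1
  have hd1 : ∀ z : ℝ × EuclideanSpace ℝ (Fin 3), DifferentiableAt ℝ (Φ z.1) z.2 := fun z =>
    ((hΦtest.contDiff_slice z.1).differentiable (by simp)).differentiableAt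
  have hlinM : (∫ z, R (fun t x => M * Φ t x) z) = M * ∫ z, R Φ z := by
    have hpt : ∀ z, R (fun t x => M * Φ t x) z = M * R Φ z := by
      intro z
      have hT : timeDeriv (fun t x => M * Φ t x) z.1 z.2 = M * timeDeriv Φ z.1 z.2 := by
        rw [timeDeriv_apply]
        exact ((hΦtest.hasDerivAt_time z.1 z.2).const_mul M).deriv
      have hG : ⟪u z.1 z.2, gradient (fun x => M * Φ z.1 x) z.2⟫ =
          M * ⟪u z.1 z.2, gradient (Φ z.1) z.2⟫ := by
        rw [EulerReynoldsLadder.inner_gradient_eq_fderiv, EulerReynoldsLadder.inner_gradient_eq_fderiv,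
          fderiv_const_mul (hd1 z)]
        rfl
      simp only [hR]
      rw [hT, hG]; ring
    rw [integral_congr_ae (Eventually.of_forall hpt), integral_const_mul]
  have hlin : (∫ z, R (fun t x => M * Φ t x - φ t x) z) = M * (∫ z, R Φ z) - ∫ z, R φ z := by
    have hpt : ∀ z, R (fun t x => M * Φ t x - φ t x) z = M * R Φ z - R φ z := by
      intro z
      have hT : timeDeriv (fun t x => M * Φ t x - φ t x) z.1 z.2 =
          M * timeDeriv Φ z.1 z.2 - timeDeriv φ z.1 z.2 := by
        rw [timeDeriv_apply]
        exact (((hΦtest.hasDerivAt_time z.1 z.2).const_mul M).sub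
          (hφ.hasDerivAt_time z.1 z.2)).deriv
      have hd2 : DifferentiableAt ℝ (φ z.1) z.2 :=
        ((hφ.contDiff_slice z.1).differentiable (by simp)).differentiableAt
      have hG : ⟪u z.1 z.2, gradient (fun x => M * Φ z.1 x - φ z.1 x) z.2⟫ =
          M * ⟪u z.1 z.2, gradient (Φ z.1) z.2⟫ - ⟪u z.1 z.2, gradient (φ z.1) z.2⟫ := by
        rw [EulerReynoldsLadder.inner_gradient_eq_fderiv, EulerReynoldsLadder.inner_gradient_eq_fderiv,
          EulerReynoldsLadder.inner_gradient_eq_fderiv, fderiv_fun_sub ((hd1 z).const_mul M) hd2,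
          fderiv_const_mul (hd1 z)]
        rfl
      simp only [hR]
      rw [hT, hG]; ring
    rw [integral_congr_ae (Eventually.of_forall hpt), integral_sub (hRΦ.const_mul M) hRφ,
      integral_const_mul]
  -- ## conclusion: `L(MΦ) = 0 = L(MΦ − φ)`, hence `L(φ) = 0`
  have e1 : M * ∫ z, R Φ z = 0 := by rw [← hlinM]; exact hL0 hMΦtest hMΦ0
  have e2 : M * (∫ z, R Φ z) - ∫ z, R φ z = 0 := by rw [← hlin]; exact hL0 hΨtest hΨ0
  linarith

/-- **Every DISCRETELY self-similar member at `ρ = 1/2` satisfies the local energy EQUALITY in the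
sense of distributions**: for `(u, p, H, c)` in the crux class at the endpoint with
`u(τ, y) = l^{3/2} u(l^{5/2}τ, l y)` (`l > 1`, `τ < 0`), the class functional vanishes on EVERY
space–time test (not only nonnegative ones): `∂_t|u|² + div((|u|²+2p)u) = 0` in `𝒟'`. [folklore] -/
theorem dss_half_localEnergyEquality_signed
    (hsw : IsSuitableWeakSolutionOn (slab (EuclideanSpace ℝ (Fin 3)) (Iio 0) isOpen_Iio) 0 0 u p)
    (hH : HasWeakSpatialGradientOn (slab (EuclideanSpace ℝ (Fin 3)) (Iio 0) isOpen_Iio) u H)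
    (hgauge : ∀ a : ℝ, 0 < a →
      ENNReal.ofReal (a ^ (2 * (1 / 2 : ℝ))) * cknA a (0 : ℝ × EuclideanSpace ℝ (Fin 3)) u +
          ENNReal.ofReal (a ^ (1 / 2 : ℝ)) * cknE a (0 : ℝ × EuclideanSpace ℝ (Fin 3)) H +
        ENNReal.ofReal (a ^ (2 * (1 / 2 : ℝ))) * cknD a (0 : ℝ × EuclideanSpace ℝ (Fin 3)) p ≤ (c : ℝ≥0∞))
    {l : ℝ} (hl : 1 < l)
    (hu : ∀ τ : ℝ, τ < 0 → ∀ y, u τ y = (l ^ (3 / 2 : ℝ)) • u (l ^ (5 / 2 : ℝ) * τ) (l • y))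
    {φ : ℝ → EuclideanSpace ℝ (Fin 3) → ℝ}
    (hφ : IsSpaceTimeTestOn (slab (EuclideanSpace ℝ (Fin 3)) (Iio 0) isOpen_Iio) φ) :
    (∫ t, ∫ x, (‖u t x‖ ^ 2 * timeDeriv φ t x +
      (‖u t x‖ ^ 2 + 2 * p t x) * ⟪u t x, gradient (φ t) x⟫)) = 0 := by
  obtain ⟨E₀, -, hE⟩ := dss_half_energy_ae_const hsw hH hgauge hl hu
  exact localEnergyEquality_of_energy_ae_const_half_signed hsw hH hgauge hE hφ

end Signed

end Summit.NavierStokesRegularity.NavierStokesRegularity.Theorems.PowerGaugeEulerLiouville
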